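import Literature.NumberTheory.ComplexMultiplication.ShimuraTaniyamaPairDegOne
import Literature.NumberTheory.ComplexMultiplication.CMTypeUniformizationCotangentCharpoly
import Literature.NumberTheory.ComplexMultiplication.ReflexNormElementCharpolyModP
import Literature.NumberTheory.NumberFields.UnramifiedPrimeNilpotentAction
import Literature.AlgebraicGeometry.Motives.GoodReductionCotangentCharpoly
import Literature.AlgebraicGeometry.Motives.AbelianVarietyCotangent
import Mathlib.LinearAlgebra.Charpoly.Basic
import HarnessLib

/-!
# `δι̃(α) = 0` on the reduction: the cotangent action of `α ∈ g(𝔭)` vanishes mod `𝔓` when `p ∤ disc K`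
# (Shimura 1998, §13.2 with §13.1 Thm. 1; proof of Thm. 18.6, p. 129)

Topic `Literature/NumberTheory/ComplexMultiplication`, namespace `Literature.NumberTheory.ComplexMultiplication`.  THEOREMS
ONLY; no definition, no named fact (net Literature debt **0**).  Cell `hodgecm-mathlib` (D-0151), row II-1 (h21), EDITION E2
«height-one road» to `shimuraTaniyamaPair_degOne'`; this is the **(P1-mod) HEAD** of A-p02's P1-SPEC / P1-skeleton — the bottom of
the registered stub `stub_tangentKill` (A-p08's closer consumes it by name) — with the four P1 stubs replaced by their landed
theorems:

* (P1-char) `GoodReductionAt.exists_monic_map_eq_charpoly_cotangentMap` (A-p11, over A-p09 (α) `GoodReductionZeroSection` and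
  A-p03 (β1) `AbelianVarietyGoodReductionCotangentLattice`): ONE monic `P ∈ 𝓞_{k,𝔓}[X]` whose images are the characteristic
  polynomials of `cotangentMap A (ιA α)` (over `k`) and of `cotangentMap Ã (ι̃A α)` (over `κ(𝔓)`);
* (P1-CM-k) `CMTypeUniformization.charpoly_cotangentMap_map_eq_prod` (B-p03): the former, read in `ℂ[X]`, is `∏_{φ∈Φ}(X − φ α)`;
* (P1-𝔭) `exists_mem_coeff_prod_cmType_eq_algebraMap` (B-p16): for `α ∈ 𝔮 = g(𝔭)` the non-leading coefficients of that product
  are images of elements of `𝔭 ⊆ 𝓞_{K*}`;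
* (P1-alg*) `NumberFields.RingOfIntegers.eq_zero_of_charpoly_eq_X_pow_of_not_dvd_discr` (B-p11): over a field of
  characteristic `p ∤ disc K` an `𝓞_K`-action whose element has characteristic polynomial `X^n` acts by zero («nilpotent ⇒ zero»,
  `𝓞_K ⊗ κ` reduced).

Hence the characteristic polynomial of `cotangentMap Ã (ι̃A α)` is `X^g`, and the action of `α` on `T_0^*(Ã)` is ZERO — Shimura's
«`δι̃(α) = 0`» of p. 129, obtained without the eigenbasis `ω̃ᵢ` of §13.2 (what «`p` unramified in `K`» buys is exactly the
reducedness of `𝓞_K ⊗ κ(𝔓)`).  The assembly body is A-p02's P1-skeleton proof verbatim.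
HC_CM is proved only modulo the 7 printed citations until rung 0 closes; banked E2 leaf, no floor change by itself.

## References
* [Shimura1998] G. Shimura, *Abelian Varieties with Complex Multiplication and Modular Functions*, §13.1 Thm. 1, §13.2
  (pp. 130–131), §18.6 proof of Thm. 18.6 (p. 129: «`δι̃(α) = 0`»), §12.4 Prop. 26.
* [Neukirch1999] J. Neukirch, *Algebraic Number Theory*, Ch. III Cor. (2.12) (`p ∤ d_K ⇔ p` unramified).
-/

noncomputable section

open CategoryTheory IsDedekindDomain NumberField AlgebraicGeometry Polynomial
open scoped NumberField nonZeroDivisors Polynomial Classical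

namespace Literature.NumberTheory.ComplexMultiplication

open Literature.AlgebraicGeometry.Motives
open Literature.AlgebraicGeometry.Motives.AbelianVariety

/-- The canonical map `𝓞 k → 𝓞_{k,𝔓} → κ(𝔓)` kills `𝔓`. [cite: Shimura1998, §13.1 (reduction modulo 𝔓)] -/
private theorem residueAt_algebraMap_eq_zero {k : Type} [Field k] [NumberField k] (𝔓 : HeightOneSpectrum (𝓞 k))
    (y : 𝓞 k) (hy : y ∈ 𝔓.asIdeal) :
    residueAt 𝔓 (algebraMap (𝓞 k) (HeightOneSpectrum.valuationSubringAtPrime k 𝔓) y) = 0 := by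
  have hmem : algebraMap (𝓞 k) (HeightOneSpectrum.valuationSubringAtPrime k 𝔓) y ∈
      IsLocalRing.maximalIdeal (HeightOneSpectrum.valuationSubringAtPrime k 𝔓) :=
    (IsLocalization.AtPrime.to_map_mem_maximal_iff (HeightOneSpectrum.valuationSubringAtPrime k 𝔓)
      𝔓.asIdeal y).mpr hy
  change (residueFieldEquiv 𝔓) (IsLocalRing.residue _ _) = 0
  rw [(IsLocalRing.residue_eq_zero_iff _).mpr hmem, map_zero]

/-- **`δι̃(α) = 0` (Shimura 1998, p. 129).**  Let `(A, ιA)` be a CM abelian variety of type `(K, Φ)` over a number field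
`k ⊇ K*` with a uniformisation `ξ`, `R` a good-reduction datum at a prime `𝔓` of `k` above `𝔭` of `K*`, of residue
characteristic `p ∤ disc K`, and `𝔮 = g(𝔭)` the reflex-type norm.  Then for every `α ∈ 𝔮` the reduced endomorphism
`ι̃A(α) = R.redEnd (ιA α)` acts by ZERO on the cotangent space of the reduction `Ã = R.reduction`.
Proof: its characteristic polynomial is the reduction of a monic `P ∈ 𝓞_{k,𝔓}[X]` lifting `char(cotangentMap A (ιA α))`
(P1-char), which over `ℂ` is `∏_{φ∈Φ}(X − φ α)` (P1-CM-k) with non-leading coefficients in `𝔭` (P1-𝔭); so it is `X^g`, and a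
nilpotent element of the reduced algebra `𝓞_K ⊗ κ(𝔓)` acting on `T_0^* Ã` is zero (P1-alg*).
[cite: Shimura1998, §18.6 proof of Thm. 18.6 (p. 129) with §13.1 Thm. 1 and §13.2] [cite: Neukirch1999, Ch. III Cor. (2.12)] -/
theorem cotangentMap_redEnd_eq_zero_of_mem_reflexNorm (K : Type) [Field K] [NumberField K] [IsCMField K]
    (Φ : CMType K) [NumberField (traceField Φ)] (k : Type) [Field k] [NumberField k] [Algebra k ℂ]
    (i₀ : traceField Φ →+* k) (hi₀ : (algebraMap k ℂ).comp i₀ = algebraMap (traceField Φ) ℂ)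
    (𝔞 : (FractionalIdeal (𝓞 K)⁰ K)ˣ) (A : AbelianVariety k) (ιA : 𝓞 K →+* End A)
    (ξ : CMTypeUniformization Φ 𝔞 A ιA) (𝔭 : HeightOneSpectrum (𝓞 (traceField Φ))) (𝔓 : HeightOneSpectrum (𝓞 k))
    (h𝔓 : 𝔓.asIdeal.comap (RingOfIntegers.mapRingHom i₀) = 𝔭.asIdeal) (p : ℕ) [ExpChar 𝔓.asIdeal.ResidueField p]
    (hdisc : ¬ ((p : ℤ) ∣ NumberField.discr K)) (𝔮 : Ideal (𝓞 K))
    (h𝔮 : ∃ (Lg : Type) (_ : Field Lg) (_ : NumberField Lg) (_ : Normal ℚ Lg) (ιL : Lg →+* ℂ)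
        (j : K →+* Lg) (σ₀ : traceField Φ →+* Lg),
        ιL.comp σ₀ = algebraMap (traceField Φ) ℂ ∧ IsReflexTypeNorm (valuedIn ιL Φ.1) j σ₀ 𝔭.asIdeal 𝔮)
    (R : A.GoodReductionAt 𝔓) (α : 𝓞 K) (hα : α ∈ 𝔮) :
    cotangentMap R.reduction (R.redEnd (ιA α) : R.reduction ⟶ R.reduction) = 0 := by
  -- `p` is the residue characteristic, a prime
  haveI : Finite 𝔓.asIdeal.ResidueField := inferInstance
  have hp : p.Prime := by
    cases ‹ExpChar 𝔓.asIdeal.ResidueField p› with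
    | zero =>
      haveI : Infinite 𝔓.asIdeal.ResidueField := Infinite.of_injective _ Nat.cast_injective
      exact (not_finite 𝔓.asIdeal.ResidueField).elim
    | prime hp => exact hp
  haveI : Fact p.Prime := ⟨hp⟩
  haveI : CharP 𝔓.asIdeal.ResidueField p := by
    cases ‹ExpChar 𝔓.asIdeal.ResidueField p› with
    | zero => exact absurd hp Nat.not_prime_one
    | prime _ => infer_instance
  set O := HeightOneSpectrum.valuationSubringAtPrime k 𝔓 with hO
  -- (P1-char): one monic `P ∈ 𝓞_{k,𝔓}[X]` with both characteristic polynomials as images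
  obtain ⟨P, hPmonic, hPred, hPgen⟩ := GoodReductionAt.exists_monic_map_eq_charpoly_cotangentMap k A 𝔓 R (ιA α)
  -- (P1-CM-k): the generic one, read in `ℂ[X]`, is `∏ (X − φ α)`
  have hC := CMTypeUniformization.charpoly_cotangentMap_map_eq_prod ξ α
  -- degrees: `g := dim A = natDegree`
  have hdegk : (cotangentMap A (ιA α : A ⟶ A)).charpoly.natDegree = Fintype.card Φ.1 := by
    have h1 := congrArg Polynomial.natDegree hC
    rw [Polynomial.natDegree_map_eq_of_injective (algebraMap k ℂ).injective,
      Polynomial.natDegree_prod_of_monic _ _ (fun σ _ => Polynomial.monic_X_sub_C _)] at h1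
    simpa using h1
  have hPdeg : P.natDegree = Fintype.card Φ.1 := by
    rw [← hdegk, ← hPgen, Polynomial.natDegree_map_eq_of_injective Subtype.val_injective]
  -- (P1-𝔭): the non-leading coefficients of `P` reduce to `0` in `κ(𝔓)`
  have hcoeff : ∀ i, i < Fintype.card Φ.1 → residueAt 𝔓 (P.coeff i) = 0 := by
    intro i hi
    obtain ⟨x, hx𝔭, hx⟩ := exists_mem_coeff_prod_cmType_eq_algebraMap K Φ 𝔭 𝔮 h𝔮 α hα i hi
    -- `P.coeff i`, read in `k`, is `i₀ x`
    have h1 : ((P.coeff i : O) : k) = algebraMap (𝓞 k) k (RingOfIntegers.mapRingHom i₀ x) := by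
      apply (algebraMap k ℂ).injective
      have h2 := congrArg (fun Q : Polynomial ℂ => Q.coeff i) hC
      simp only [Polynomial.coeff_map] at h2
      rw [← hPgen, Polynomial.coeff_map] at h2
      change algebraMap k ℂ ((P.coeff i : O) : k) = _ at h2
      rw [h2, hx, ← hi₀]
      rfl
    have hy : RingOfIntegers.mapRingHom i₀ x ∈ 𝔓.asIdeal := by
      rw [← Ideal.mem_comap, h𝔓]; exact hx𝔭
    have h3 : P.coeff i = algebraMap (𝓞 k) O (RingOfIntegers.mapRingHom i₀ x) := by
      apply Subtype.val_injective
      rw [h1]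
      rfl
    rw [h3]
    exact residueAt_algebraMap_eq_zero 𝔓 _ hy
  -- hence the special characteristic polynomial is `X ^ g`
  have hXpow : (cotangentMap R.reduction (R.redEnd (ιA α) : R.reduction ⟶ R.reduction)).charpoly =
      Polynomial.X ^ Fintype.card Φ.1 := by
    rw [← hPred]
    apply Polynomial.ext
    intro i
    rw [Polynomial.coeff_map, Polynomial.coeff_X_pow]
    rcases lt_trichotomy i (Fintype.card Φ.1) with hi | rfl | hi
    · rw [if_neg (ne_of_lt hi), hcoeff i hi]
    · rw [if_pos rfl, ← hPdeg, Polynomial.coeff_natDegree, hPmonic.leadingCoeff, map_one]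
    · rw [if_neg (ne_of_gt hi), Polynomial.coeff_eq_zero_of_natDegree_lt (hPdeg ▸ hi), map_zero]
  have hfin : Module.finrank 𝔓.asIdeal.ResidueField (Cotangent R.reduction) = Fintype.card Φ.1 := by
    rw [← LinearMap.charpoly_natDegree (cotangentMap R.reduction (R.redEnd (ιA α) : R.reduction ⟶ R.reduction)),
      hXpow, Polynomial.natDegree_pow, Polynomial.natDegree_X, mul_one]
  -- the `𝓞_K`-action on the cotangent space of `Ã`, as a ring homomorphism
  let ρ : 𝓞 K →+* Module.End 𝔓.asIdeal.ResidueField (Cotangent R.reduction) :=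
    (cotangentMapRingHom R.reduction).comp
      ((R.redEnd.comp ιA).toOpposite fun x y => by
        change R.redEnd (ιA x) * R.redEnd (ιA y) = R.redEnd (ιA y) * R.redEnd (ιA x)
        rw [← map_mul, ← map_mul, ← map_mul, ← map_mul, mul_comm])
  have hρ : ρ α = cotangentMap R.reduction (R.redEnd (ιA α) : R.reduction ⟶ R.reduction) := by
    change cotangentMapRingHom R.reduction (MulOpposite.op (R.redEnd (ιA α))) = _
    rw [cotangentMapRingHom_apply]
    rfl
  -- (P1-alg*): nilpotent ⇒ zero
  have h0 := NumberFields.RingOfIntegers.eq_zero_of_charpoly_eq_X_pow_of_not_dvd_discr K 𝔓.asIdeal.ResidueField p hdisc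
    (Cotangent R.reduction) ρ α (by rw [hρ, hXpow, hfin])
  rw [← hρ, h0]

end Literature.NumberTheory.ComplexMultiplication

end
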